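import Summits.HubbardSuperconductivity.HubbardLadder.Bounds.OpenBoxStripLimit

/-!
# Bilinear open-box bound ⇒ thermodynamic-limit energy density (glue for b = ∞ plane certificates)

The landed strip consumer `energyDensityTT'_le_of_openBox_linear` turns a bound
`E_open(a × b; N) ≤ c·ab + C` holding for infinitely many lengths `a` at ONE fixed width `b` into
`e(t,t',U; n) ≤ c`.  A translation-invariant finite-light-cone PLANE certificate (UPPER-IDEA-2 §4 "BD-PLANE",
seat-A NOTE-S6 'U1-2D'; design memo HOME/hubbard-upper-plane-1/DESIGN-U3-BDPLANE-OPTIMISER.md §3.5) delivers instead,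
for every width `b ≥ 1` and infinitely many `a`, the BILINEAR bound
`E_open(a × b; N a b) ≤ c·ab + C₁·a + C₂·b + C₃` (edge rows `∝ a`, end columns and the particle-number sector `∝ b`).
This file is the 15-line glue: apply the strip consumer at each `b` with slope `c + C₁/b` and constant `C₂ b + C₃`,
then let `b → ∞`.  Nothing here is specific to the plane ansatz.  [cite: Ruelle1969, §3.3]
-/

noncomputable section

namespace Summit.HubbardSuperconductivity.HubbardLadder.Bounds

open Filter
open Literature.MathematicalPhysics.QuantumLattice
open Literature.MathematicalPhysics.QuantumLattice.HubbardWave0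
open Literature.MathematicalPhysics.QuantumLattice.ThermodynamicLimit

/-- **Plane limit of the open-box consumer (`a → ∞` then `b → ∞`).** Let `U ≥ 0`, `n < 2`, reals
`c, C₁, C₂, C₃` and particle numbers `N a b`. If for every width `b ≥ 1` there are infinitely many lengths `a`
at which the open `a × b` cluster carries `N a b = n·a·b` particles and
`E_open(a × b; N a b) ≤ c·(ab) + C₁·a + C₂·b + C₃`, then `e(t, t', U; n) ≤ c`:
at fixed `b` this is the linear hypothesis of `energyDensityTT'_le_of_openBox_linear` with slope `c + C₁/b`
and constant `C₂ b + C₃`, whence `e ≤ c + C₁/b` for every `b ≥ 1`. [cite: Ruelle1969, §3.3] -/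
theorem energyDensityTT'_le_of_openBox_bilinear (t t' : ℝ) {U : ℝ} (hU : 0 ≤ U) {n : ℝ} (hn2 : n < 2)
    (c C₁ C₂ C₃ : ℝ) (N : ℕ → ℕ → ℕ)
    (h : ∀ b : ℕ, 1 ≤ b → ∃ᶠ a : ℕ in atTop, ((N a b : ℕ) : ℝ) = n * ((a : ℝ) * (b : ℝ)) ∧
      groundEnergy (hubbardOpenBoxTT' a b t t' U) (N a b) ≤
        c * ((a : ℝ) * (b : ℝ)) + C₁ * (a : ℝ) + C₂ * (b : ℝ) + C₃) :
    energyDensityTT' t t' U n ≤ c := by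
  refine le_of_forall_pos_le_add fun ε hε => ?_
  -- a width `b ≥ max 1 (|C₁|/ε)`
  obtain ⟨b, hb⟩ : ∃ b : ℕ, max 1 (|C₁| / ε) ≤ (b : ℝ) := ⟨⌈max 1 (|C₁| / ε)⌉₊, Nat.le_ceil _⟩
  have hb1r : (1 : ℝ) ≤ (b : ℝ) := (le_max_left _ _).trans hb
  have hb1 : 1 ≤ b := by exact_mod_cast hb1r
  have hbpos : (0 : ℝ) < (b : ℝ) := by linarith
  -- the strip consumer at this width, slope `c + C₁/b`, constant `C₂ b + C₃`
  have key : energyDensityTT' t t' U n ≤ c + C₁ / (b : ℝ) := by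
    refine energyDensityTT'_le_of_openBox_linear t t' hU hb1 hn2 (c + C₁ / (b : ℝ)) (C₂ * (b : ℝ) + C₃)
      (fun a => N a b) ((h b hb1).mono ?_)
    rintro a ⟨hN, hE⟩
    refine ⟨hN, hE.trans (le_of_eq ?_)⟩
    have hbne : (b : ℝ) ≠ 0 := hbpos.ne'
    field_simp
    ring
  -- `C₁/b ≤ |C₁|/b ≤ ε`
  have hC : C₁ / (b : ℝ) ≤ ε := by
    have h1 : C₁ / (b : ℝ) ≤ |C₁| / (b : ℝ) := div_le_div_of_nonneg_right (le_abs_self C₁) hbpos.le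
    have h2 : |C₁| / (b : ℝ) ≤ ε := by
      rw [div_le_iff₀ hbpos]
      have hb' : |C₁| / ε ≤ (b : ℝ) := (le_max_right _ _).trans hb
      have := (div_le_iff₀ hε).1 hb'
      linarith
    linarith
  linarith

end Summit.HubbardSuperconductivity.HubbardLadder.Bounds
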